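import Summits.BirchSwinnertonDyer.Rank1Residual.Additive.PotSupersingularClasses
import Summits.BirchSwinnertonDyer.Rank1Residual.Additive.FouquetWanLocus
import HarnessLib

/-!
# Local irreducibility of `E[p]` at a TAME potentially supersingular additive prime `p ≥ 5` READ OFF
# `(v_p(c₄), v_p(c₆), v_p(Δ_min))`: the CANONICAL-SUBGROUP criterion (harvest-2 E94) — the `p ≥ 5` twin of
# `Additive/LocIrrValuationCriterionThree.lean`; EVIDENCE-labelled conjecture node + census-decidable predicate
# (cell `b2b-bsdres`, lane CLASS-CLOSURE, class O5 at `p ≥ 5`; seat cc-typer-5 GEN 9 = O5/O6 typer of record;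
#  deliverable (a) STATEMENT DISCOVERY: the discovered statement typed with its pre-registered held-out validation;
#  0 named Literature facts, net debt 0; nothing asserted)

HONEST FRAMING (cell `b2b-bsdres`, run/shared/lean/b2b/bsd-rank1-residual/, verbatim in every file):
the goal of the cell is to DELETE the COMBINATION-SHAPED residual classes of the Birch–Swinnerton-Dyer
formula for ALL analytic-rank `≤ 1` elliptic curves over `ℚ` — "full BSD formula for every rank `≤ 1`
curve in class `C`" assembled STRICTLY from published theorems — so that the rank-`≤ 1` remainder
becomes exactly the CONSTRUCTION-SHAPED classes, which are TYPED (missing-input `Prop`s), NOT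
attempted. This is not "finishing BSD". Lane CLASS-CLOSURE (`CLASS-CLOSURE-PLAN.md` §3.5 O5): research
routes; no claim beyond the stated classes; census output is EVIDENCE, never a Literature fact; nothing is
booked; no mark of `RESIDUAL-MAP.md` moves. This file: ONE census-decidable predicate, ONE `@[conjecture]`
node (a THEOREM-CANDIDATE with a written elementary derivation, NOT kernel-checked, NOT asserted), and
proved bookkeeping on the predicate.

## Why (harvest-2 GEN 43 E94, `HOME/b2b-bsdres-harvest-2/gen43/E94-F25-B2-correction.md` sha16 0287d86bcc8514d2,
## INBOX 2026-08-21T18:42Z; cc-eng-3 GEN 10 LOCRED5-2ENG v1, INBOX 19:04Z / 19:08Z; census-lead pass 12 A-176)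

The census column (B2) of F25-ELIG v1.2/1.3 decided the Fouquet–Wan (Lgl) bit `LocIrr W p` (`E[p]|G_{ℚ_p}`
irreducible, `Additive/FouquetWanLocus.lean`) at additive potentially good `p ≥ 5` by the rule "potentially
supersingular ∧ `(p+1) ∤ e` ⟹ LocIrr". E94 shows the rule is FALSE for `e ∈ {3, 4, 6}`: over
`K = ℚ_p(p^{1/e})` the good model can be "not too supersingular" — if its Hasse invariant has
`v_K(H) < e·p/(p+1)` the Newton polygon of `[p]` on the formal group has TWO slopes, the `p − 1` points of
large valuation form a CANONICAL SUBGROUP `C` of order `p`, `G_{ℚ_p}`-stable by the valuation argument, so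
`E[p]|G_{ℚ_p}` is REDUCIBLE although the reduction over `K` is supersingular; with one slope, inertia acts
through `ω₂^a` with `a = 1 − m(p² − 1)/e` ODD, and `E[p]|G_{ℚ_p}` is irreducible. Computing `v_K(H)` from the
`p`-minimal model (Hasse invariant = coefficient of `X^{p−1}` in `f^{(p−1)/2}`) gives the CRITERION below:
**LocRed iff the "free" invariant (`c₄` on the `j̃ = 0` types II, IV, IV*, II*; `c₆` on the `j̃ = 1728` types
III, III*) takes the MINIMAL valuation its Kodaira type allows**; `e = 2` (I₀*) potentially supersingular rows
are always LocIrr. (The potentially ORDINARY half "pot-ord ⟹ LocRed" is correct as printed and is the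
N10 axis, `TypeGOrd`, not restated here.)

## What is typed

* `CanonicalSubgroupCriterion p W` — E94 §0.2's LocRed side on a globally minimal `W` (so `p`-minimal), by
  `v_p(Δ_min) ∈ {2, 10, 4, 8, 3, 9}` (II, II*, IV, IV*, III, III*) and the free invariant's valuation
  `v_p(c₄) = 1, 4, 2, 3` resp. `v_p(c₆) = 2, 5`. Lean's junk value `v_p(0) = 0` is never one of these minimal
  values, so `j = 0` (`c₄ = 0`) and `j = 1728` (`c₆ = 0`) curves — CM, LocIrr at a supersingular `p` — fall on
  the LocIrr side as they must (E94 §3: `y² = x³ + 25` at `5`, `y² = x³ + 7x` at `7`). At `v_p(Δ) = 6` (I₀*,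
  `e = 2`) no disjunct applies.
* **T-O5-CS `LocIrrTameIffNoCanonicalSubgroup` (`@[conjecture]`, THEOREM-CANDIDATE):** for every prime `p ≥ 5`
  and every elliptic, globally minimal `W/ℚ` in class O5 at `p` (`ClassO5 W p`: additive, TAME potentially
  SUPERSINGULAR — `(G) ∧ ss` ∪ `(t′)`), `LocIrr W p ↔ ¬ CanonicalSubgroupCriterion p W`.
* PROVED bookkeeping: `canonicalSubgroupCriterion_false_of_Δ_six` (the `e = 2` rows are on the LocIrr side of
  the criterion), `not_canonicalSubgroupCriterion_of_c₄_c₆_zero`-type junk-corner lemmas, and the `decide`d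
  transcription check `e94Table_verdicts` of E94 §3's 21 local examples against the rule.

EVIDENCE (never a proof): E94 §3 — 21 / 21 local examples by the Newton polygon of `Ψ_p` (pure python
`gen43/src/psi_np.py`); **LOCRED5-2ENG v1** (cc-eng-3 GEN 10; PRE-REGISTERED `class-closure/eng-3/code/locred/
LOCRED5-2ENG-PREREG.md` sha16 835f79705f7f285a, published 18:57Z BEFORE the table `relations/LOCRED5-2ENG-v1.tsv`
d192065f3405dd32 / summary 21e59ca3a5da03c6, census pass 12 A-176 'IN ORDER'): on the 12 527 potentially good
X4 `r = 0`, `p ≥ 5` cells of F25-ELIG v1.3 (a84d4dc295b3315a) — C1 E94's closed-form table = ENGINE H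
(first-principles lifted Hasse coefficient over `ℚ_p(p^{1/e})`, no case table) 12 527 / 12 527; C2 ENGINE NP
(exact `Ψ_p` + Newton polygon, `p ≤ 31`, 12 228 rows): LocRed-shape ⟺ H ∈ {ORD, CANON} 12 228 / 12 228 AND
the valuation multiset = H's prediction exactly 12 228 / 12 228; C3 `H̄ = 0` ⟺ pot-ss 12 527 / 12 527;
**C4 HELD-OUT 567 / 567** on the rows whose (Lgl) bit is decided by TRANSPORT from a certified congruence
partner, independently of local data (`(5; II*)`: 531 good-ordinary-partner + 26 multiplicative-partner rows
= CANON with `v₅(c₄) = 4`; 10 good-supersingular-partner rows = NOCANON with `v₅(c₄) = 5`); C0 planted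
controls 21 / 21 in every piece; 0 findings. Label (census-lead pass 12): EVIDENCE, TWO-IMPLEMENTATION (one
seat, method-disjoint) on the 12 228 `p ≤ 31` rows, SINGLE-IMPLEMENTATION PROVISIONAL on the 299 `p > 31`
rows. O5 tally: 5 638 pot-ss cells = CANON (LocRed) 3 971 / NOCANON (LocIrr) 1 667 (`e = 2`: 739, all
NOCANON). Falsifier: one curve over `ℚ`, additive tame potentially supersingular at some `p ≥ 5`, on which
`polrootspadic(Ψ_p, p)` / the NP of `Ψ_p` and the criterion disagree.

E96 NOTE (cc-typer-5 GEN 10, 2026-08-21; DOC-ONLY — every declaration and statement below is byte-identical to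
p300590, tags unchanged). harvest-2 GEN 44 **E96** (`HOME/b2b-bsdres-harvest-2/gen44/E96-LocRed-B-table.md`
sha16 `7cef2e99b6389626`, per-row table `gen44/src/E96-B-DECISION.tsv` `b62233bdaea74d9e` = every ORD | CANON row
of LOCRED5-2ENG-v1; `HOME/INBOX.md` 2026-08-21T19:48Z / P.S. 19:51Z): (0) cc-eng-2's F25-ELIG v1.4 (B2) column IS
this predicate (E94 on all 12 527 pot-good rows; three computations agree — NO deviation to record); (1) **ERRATUM
to E94 §0.2 item 2, last sentence: the `(5; II*)` CANON shape is `(ωμ ∗; 0 μ⁻¹)` — the ordinary, non-split shape —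
NOT `(μ ∗; 0 ωμ⁻¹)`; only `(5; II)` CANON has the unramified sub.** The criterion, the table `e94Table` and every
docstring here are UNAFFECTED (this file cites E94 §0.2 only for the decision rule, never for that shape);
(2) NEW READINGS for the O5 CANON cells (recorded as EVIDENCE text, not typed — a 'stable-line inertia character'
vocabulary is not in the tree): every CANON row is NON-SPLIT (elementary: the non-`C` `x`-roots have `p` in the
valuation denominator, E96 §1.5), and the `G_{ℚ_p}`-stable line `C` has `θ|_I = ω^a` with
`a = (e − h − m(p−1))/e` (`m = e·v(Δ)/12`, `h = vKH`; at `p = 5`: (II) CANON `a = 0`, (II*) CANON `1`, (IV) CANON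
`3`, (IV*) CANON `2`), quotient `ω^{1−a}` — consistent with Kraus 1997 as restated by Billerey, IJNT 2011, Prop. 2.3 /
Rem. [corpus: paper:arxiv-0908.1084 p0006 L68–98]; uniformly "free invariant minimal ⟺ `W[p]|G_{ℚ_p}` a NON-split
extension; non-minimal ⟺ semisimple (irreducible if pot-ss — this node —, split if pot-ord)"; numerics 0 exceptions
(criterion (S) vs PARI split test 2 754 + 503, off-diagonal 0 + 0, `p ≤ 13`; laws L1 / L2 / CANON-never-split
0 / 9 569; transport cross-check on the 557 `(5; II*)` rows 225/225 + 306/306 + 26/26). E96's criterion (S) lives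
on the pot-ORDINARY rows — the N10 axis (`TypeGOrd`, cc-typer-2's pen) — and is NOT typed here; the O5 tally
(5 638 pot-ss cells = CANON 3 971 reducible non-split / NOCANON 1 667 irreducible; at `p = 5` the (II) / (IV*) CANON
cells contain 301 + 408 OUT(B) rows of shape `μ ⊗ (1 ∗; 0 ω)`, `μ² = 1`, outside Fouquet / CW / Nakamura) is
census EVIDENCE; nothing booked; no mark of `RESIDUAL-MAP.md` moves; O5 OPEN.

Literature status (harvest-2 presearch, corpus hybrid + vsearch + galaxy): DERIVATION + numerics; every step
standard (formal groups, `[p] ≡ V∘F`, Hasse invariant, Newton polygon, canonical subgroup); the table is not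
found in print in this form; expected to be a case of A. Kraus, *Détermination du poids et du conducteur
associés aux représentations des points de p-torsion d'une courbe elliptique*, Dissertationes Math. 364
(1997) (acq-09682, not held). Hence a Summits-side conjecture node (our computation), NOT a Literature fact.
Missing for a kernel proof: the formal group of the twisted good model over `ℚ_p(p^{1/e})`, `[p] ≡ V ∘ F` and
the Hasse invariant as a coefficient, the two-slope ⟹ canonical-subgroup argument, the `Ψ_p`-root ↔
stable-line dictionary at general `p` (the tree has it at `p = 3` only: `ModThreeReducibleIffPsi3Root`).

References: harvest-2 E94 (above); N. M. Katz, B. Mazur, *Arithmetic Moduli of Elliptic Curves*, 12.4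
(Hasse invariant); J. H. Silverman, AEC IV (formal groups), V; J.-P. Serre, Invent. Math. 15 (1972) §1
[SerreInventiones1972]; I. Papadopoulos, J. Number Theory 44 (1993) (the `(v(c₄), v(c₆), v(Δ))` table at
`p ≥ 5`) [Papadopoulos1993]; O. Fouquet, X. Wan, arXiv:2107.13726 Thm 5.1 [FouquetWan2021];
`class-closure/relations/LOCRED5-2ENG-v1.README.md` 3178491a5d1476c2; `class-closure/O5/TYPED.md` §13.
-/

set_option autoImplicit false

noncomputable section

open scoped Classical

open WeierstrassCurve Literature.NumberTheory.EllipticCurves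
  Literature.NumberTheory.EllipticCurves.Rank1Residual
  Literature.NumberTheory.EllipticCurves.Rank1Residual.Typed

namespace Summit.BirchSwinnertonDyer.Rank1Residual.Additive

/-! ## §1 The criterion (census-decidable; columns `lr5_kod`, `lr5_v_c4`, `lr5_v_c6` of RELATIONS-v2.7) -/

/-- **The canonical-subgroup criterion at `p ≥ 5`** (E94 §0.2, LocRed side), on a globally minimal `W`:
the free invariant has the MINIMAL valuation allowed by the Kodaira type at `p`, the type being read from
`v_p(Δ_min)`: II (`2`): `v_p(c₄) = 1` · II* (`10`): `v_p(c₄) = 4` · IV (`4`): `v_p(c₄) = 2` · IV* (`8`):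
`v_p(c₄) = 3` · III (`3`): `v_p(c₆) = 2` · III* (`9`): `v_p(c₆) = 5`; nothing at I₀* (`6`). Junk-safe:
`v_p(0) = 0` in Lean is never a listed value. Census name: `H = CANON`. [folklore] -/
def CanonicalSubgroupCriterion (p : ℕ) (W : WeierstrassCurve ℚ) : Prop :=
  (padicValRat p W.Δ = 2 ∧ padicValRat p W.c₄ = 1) ∨ (padicValRat p W.Δ = 10 ∧ padicValRat p W.c₄ = 4) ∨
  (padicValRat p W.Δ = 4 ∧ padicValRat p W.c₄ = 2) ∨ (padicValRat p W.Δ = 8 ∧ padicValRat p W.c₄ = 3) ∨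
  (padicValRat p W.Δ = 3 ∧ padicValRat p W.c₆ = 2) ∨ (padicValRat p W.Δ = 9 ∧ padicValRat p W.c₆ = 5)

/-- At `v_p(Δ) = 6` (Kodaira I₀*, `e = 2`) the criterion never fires: the `e = 2` potentially supersingular
rows are on the LocIrr side, as E94 §0.2 says (`W = W′ ⊗ χ`, `W′` good supersingular). [folklore] -/
theorem canonicalSubgroupCriterion_false_of_Δ_six {p : ℕ} {W : WeierstrassCurve ℚ}
    (h6 : padicValRat p W.Δ = 6) : ¬ CanonicalSubgroupCriterion p W := by
  unfold CanonicalSubgroupCriterion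
  rw [h6]
  norm_num

/-- Junk corner `c₄ = 0` (`j = 0`): the II / II* / IV / IV* disjuncts fail (Lean's `v_p(0) = 0`), so only a
III / III* disjunct could fire — and on those types `c₆`, not `c₄`, is the free invariant. [folklore] -/
theorem canonicalSubgroupCriterion_of_c₄_eq_zero {p : ℕ} {W : WeierstrassCurve ℚ} (h : W.c₄ = 0) :
    CanonicalSubgroupCriterion p W ↔
      (padicValRat p W.Δ = 3 ∧ padicValRat p W.c₆ = 2) ∨ (padicValRat p W.Δ = 9 ∧ padicValRat p W.c₆ = 5) := by
  unfold CanonicalSubgroupCriterion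
  rw [h, padicValRat.zero]
  norm_num

/-- Junk corner `c₆ = 0` (`j = 1728`): the III / III* disjuncts fail. [folklore] -/
theorem canonicalSubgroupCriterion_of_c₆_eq_zero {p : ℕ} {W : WeierstrassCurve ℚ} (h : W.c₆ = 0) :
    CanonicalSubgroupCriterion p W ↔
      (padicValRat p W.Δ = 2 ∧ padicValRat p W.c₄ = 1) ∨ (padicValRat p W.Δ = 10 ∧ padicValRat p W.c₄ = 4) ∨
      (padicValRat p W.Δ = 4 ∧ padicValRat p W.c₄ = 2) ∨ (padicValRat p W.Δ = 8 ∧ padicValRat p W.c₄ = 3) := by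
  unfold CanonicalSubgroupCriterion
  rw [h, padicValRat.zero]
  norm_num

/-! ## §2 The node (THEOREM-CANDIDATE; EVIDENCE-labelled; nothing asserted) -/

/-- **T-O5-CS `LocIrrTameIffNoCanonicalSubgroup` (THEOREM-CANDIDATE, harvest-2 E94 §0.2 / §2; `@[conjecture]`
by the lane rule until a kernel proof).** For every prime `p ≥ 5` and every elliptic, globally minimal `W/ℚ`
in class O5 at `p` (`ClassO5 W p`: `p` odd additive, TAME potentially SUPERSINGULAR = `(G) ∧ ss` ∪ `(t′)`):
`E[p]|G_{ℚ_p}` is irreducible (`LocIrr W p`, the Fouquet–Wan (Lgl) bit) iff the canonical-subgroup criterion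
FAILS, i.e. iff the free invariant does NOT have its minimal valuation (`e = 2` rows: always LocIrr).
Derivation (E94 §1–§2): `[p](T) = pT + … + c_pT^p + … + c_{p²}T^{p²} + …` on the formal group of the good model
over `K = ℚ_p(p^{1/e})`, `c_p ≡ H` (Hasse invariant); TWO Newton slopes ⟺ `v_K(H) ≤ e − 1` ⟺ the table
(IV: `3v(A) − 4 ≤ 2`, IV*: `3v(A) − 8 ≤ 2`, II: `6v(A) − 4 ≤ 5`, II*: `6v(A) − 20 ≤ 5`, III: `4v(B) − 6 ≤ 3`,
III*: `4v(B) − 18 ≤ 3`), and two slopes ⟺ a `G_{ℚ_p}`-stable canonical subgroup ⟺ LocRed; one slope ⟹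
inertia through `ω₂^a`, `a` odd ⟹ LocIrr. Why it might fail: only inside that derivation (the `e = 2` and
pot-ordinary halves are classical); a falsifier is one curve where the NP of `Ψ_p` disagrees.
[cite: SerreInventiones1972, §1 (formal group of height 2, one slope at e = 1)]
[evidence: census cell O5, LOCRED5-2ENG v1 (cc-eng-3 GEN 10; prereg 835f79705f7f285a BEFORE table d192065f3405dd32): C1 12 527/12 527 (E94 table = ENGINE H), C2 12 228/12 228 (ENGINE NP shape AND valuation multiset), C3 12 527/12 527, C4 HELD-OUT 567/567 transport-decided rows, C0 21/21 controls, 0 findings; O5 pot-ss cells CANON 3 971 / NOCANON 1 667; E94 §3 21/21 local examples; label EVIDENCE two-implementation (p ≤ 31) / single-implementation provisional (299 rows p > 31)] -/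
@[conjecture] def LocIrrTameIffNoCanonicalSubgroup : Prop :=
  ∀ (p : ℕ) [Fact p.Prime], 5 ≤ p →
    ∀ (W : WeierstrassCurve ℚ) [W.IsElliptic] [W.IsGloballyMinimal],
      ClassO5 W p → (LocIrr W p ↔ ¬ CanonicalSubgroupCriterion p W)

/-! ## §3 Kernel corollaries granted the node (nothing asserted beyond it) -/

section Corollaries

variable {p : ℕ} [Fact p.Prime] (W : WeierstrassCurve ℚ) [W.IsElliptic] [W.IsGloballyMinimal]

/-- Granted T-O5-CS: an O5 curve with `v_p(Δ_min) = 6` (`e = 2`, the `(G) ∧ ss` = I₀* rows) is LocIrr at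
`p ≥ 5`. [folklore] -/
theorem locIrr_of_Δ_six (h : LocIrrTameIffNoCanonicalSubgroup) (hp : 5 ≤ p) (hO : ClassO5 W p)
    (h6 : padicValRat p W.Δ = 6) : LocIrr W p :=
  (h p hp W hO).mpr (canonicalSubgroupCriterion_false_of_Δ_six h6)

/-- Granted T-O5-CS: a LocRed (`¬ LocIrr`) O5 curve at `p ≥ 5` satisfies the criterion — its free invariant has
the minimal valuation (the census's CANON rows, 3 971 / 5 638). [folklore] -/
theorem canonicalSubgroupCriterion_of_not_locIrr (h : LocIrrTameIffNoCanonicalSubgroup) (hp : 5 ≤ p)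
    (hO : ClassO5 W p) (hred : ¬ LocIrr W p) : CanonicalSubgroupCriterion p W := by
  by_contra hc
  exact hred ((h p hp W hO).mpr hc)

end Corollaries

/-! ## §4 Transcription check: E94 §3's 21 local examples against the rule (data only; `decide`d) -/

/-- One row of E94 §3: `(p, v_p(Δ), v_p(free invariant) — 99 encodes "∞" (invariant = 0) —, predicted LocRed?)`.
[folklore] -/
abbrev E94Row : Type := ℕ × ℕ × ℕ × Bool

/-- The rule of §1 on abstract valuation data `(v(Δ), v(free))`: LocRed iff the pair is one of the six minimal
ones. (For `v(Δ) ∈ {3, 9}` the free invariant is `c₆`, else `c₄`; the row supplies the right one.) [folklore] -/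
def e94Rule (vΔ vfree : ℕ) : Bool :=
  (vΔ == 2 && vfree == 1) || (vΔ == 10 && vfree == 4) || (vΔ == 4 && vfree == 2) || (vΔ == 8 && vfree == 3) ||
  (vΔ == 3 && vfree == 2) || (vΔ == 9 && vfree == 5)

/-- E94 §3's table (21 curves `y² = x³ + Ax + B`; columns `p`, `v_p(Δ)` of the type, `v_p` of the free invariant
(`99` = invariant `0`), predicted-and-observed LocRed): (7; III v(B)=2 ✓LocRed), (7; III 3), (7; III ∞),
(7; III* 5 ✓), (7; III* 6), (7; III 2 ✓), (5; II 1 ✓), (5; II 2), (5; II* 4 ✓), (5; II* 5), (5; IV ∞), (5; IV 2 ✓),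
(5; IV 2 ✓), (5; IV* 3 ✓), (5; IV* 4), (11; IV 2 ✓), (11; IV 3), (11; III 2 ✓), (11; III 3), (11; II 1 ✓), (11; II 2).
[folklore] -/
def e94Table : List E94Row :=
  [(7, 3, 2, true), (7, 3, 3, false), (7, 3, 99, false), (7, 9, 5, true), (7, 9, 6, false), (7, 3, 2, true),
   (5, 2, 1, true), (5, 2, 2, false), (5, 10, 4, true), (5, 10, 5, false), (5, 4, 99, false), (5, 4, 2, true),
   (5, 4, 2, true), (5, 8, 3, true), (5, 8, 4, false), (11, 4, 2, true), (11, 4, 3, false), (11, 3, 2, true),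
   (11, 3, 3, false), (11, 2, 1, true), (11, 2, 2, false)]

/-- The 21 recorded verdicts ARE the rule's values (transcription check of E94 §3 against §1; kernel `decide`).
[folklore] -/
theorem e94Table_verdicts : ∀ r ∈ e94Table, e94Rule r.2.1 r.2.2.1 = r.2.2.2 := by decide

/-- The table has 21 rows, 11 LocRed and 10 LocIrr. [folklore] -/
theorem e94Table_count :
    e94Table.length = 21 ∧ (e94Table.filter (fun r => r.2.2.2)).length = 11 := by decide

end Summit.BirchSwinnertonDyer.Rank1Residual.Additive

end
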